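import Mathlib
import Literature.NumberTheory.Transcendental.ZagierDilogarithmConjecture
import Literature.NumberTheory.Transcendental.BlochWignerDilogarithm
import Literature.NumberTheory.Transcendental.BlochWignerDilogarithmProofs
import Summits.KontsevichZagierPeriods.KontsevichZagierPeriods.Theorems.HyperbolicBlochZagierDilogarithmConjectureStubKummerDescent
import Summits.KontsevichZagierPeriods.KontsevichZagierPeriods.Theorems.HyperbolicBlochZagierDilogarithmConjectureStubCyclotomicIndependence
import Summits.KontsevichZagierPeriods.KontsevichZagierPeriods.Theorems.HyperbolicBlochZagierDilogarithmConjectureStubCyclotomicPrimeSectorIff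
import HarnessLib

/-!
# `ZagierDilogarithmConjecture` (stmt-KontsevichZagierPeriods-10550) — line `kummer-clausen-linearisation`
(reshape c5, "the cyclotomic tower and the abelian sector"), stub `stub_cyclotomicSectorTorsion_iff`

**The full cyclotomic sector of Zagier's conjecture at level `N`, in torsion form, is EQUIVALENT to
Milnor's conjecture for `N` — every `N`, composite included.** Let `ζ_N = e^{2πi/N}`, `D` the
Bloch–Wigner dilogarithm (`blochWignerDilog`) and `⟨dilogRelators⟩ ⊆ ℤ[ℂ]` the relator group of Zagier's
dilogarithm conjecture (Neumann 1998, §2.1). Assume FOLDING (the hypothesis, proved by the neighbouring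
stub `stub_cyclotomicFolding`): every `x = Σ_c m_c [ζ_N^c] ∈ ℤ[μ_N]` has a positive multiple `M·x`
congruent modulo `⟨dilogRelators⟩` to a combination `y = Σ_a b_a [ζ_N^a]` supported on the units of the
open upper half (`(a, N) = 1`, `0 < a < N/2`). Then the following are equivalent:

* (the level-`N` cyclotomic sector, torsion form) every `ℤ`-relation `Σᵢ nᵢ D(uᵢ) = 0` among `N`-th
  roots of unity `uᵢ` of the open upper half plane (imprimitive ones allowed) has a positive multiple of
  its formal combination explained: `M · Σᵢ nᵢ [uᵢ] ∈ ⟨dilogRelators⟩` for some `M ≥ 1`;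
* (Milnor's conjecture for `N`, `ℤ`-form) the Clausen values `D(ζ_N^c)`, `(c, N) = 1`, `0 < c < N/2`,
  admit only the trivial `ℤ`-relation (Milnor 1982, Appendix).

This upgrades c4's `stub_cyclotomicPrimeSector_iff` from a prime level to an arbitrary level; the
neighbouring stub `stub_allRootsOfUnity_iff` assembles all levels.

Proof. `⇒`: given `m : ℤ/N → ℤ` supported on the upper-half units with `Σ_c m_c D(ζ_N^c) = 0`, index
the support `S = {c | m_c ≠ 0} ≃ Fin k` and feed the family `uᵢ = ζ_N^{cᵢ}` (an `N`-th root of unity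
with `Im = sin(2πcᵢ/N) > 0`) to the sector statement: `M · Σ_c m_c [ζ_N^c] ∈ ⟨dilogRelators⟩` for some
`M ≥ 1`, i.e. `Σ_c (M m_c) [ζ_N^c]` is explained, with `M·m` supported on the upper-half units; the
UNCONDITIONAL cyclotomic independence theorem `stub_cyclotomicIndependence` (c4) forces `M·m = 0`,
hence `m = 0`. `⇐`: an `N`-th root of unity of `ℍ⁺` is `ζ_N^c` with `0 < c < N/2`
(`CyclotomicPrimeSector.exists_eq_zeta_pow`); group a family `(uᵢ, nᵢ)` by the exponent,
`m_d = Σ_{i : cᵢ = d} nᵢ`, so `x := Σᵢ nᵢ [uᵢ] = Σ_d m_d [ζ_N^d]` and `Σ_d m_d D(ζ_N^d) = Σᵢ nᵢ D(uᵢ) = 0`.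
Fold: `M·x − y ∈ ⟨dilogRelators⟩` with `y = Σ_a b_a [ζ_N^a]` supported on the upper-half units. The
value homomorphism `[w] ↦ D(w)` kills `⟨dilogRelators⟩` (soundness, `lift_eq_zero_of_mem_closure`), so
`Σ_a b_a D(ζ_N^a) = M · Σ_d m_d D(ζ_N^d) = 0`, and Milnor's conjecture gives `b = 0`, `y = 0`,
`M·x ∈ ⟨dilogRelators⟩`. Sorry-free; axioms ⊆ {propext, Classical.choice, Quot.sound}.

## References

* W. D. Neumann, *Hilbert's 3rd problem and invariants of 3-manifolds*, Geom. Topol. Monogr. 1 (1998),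
  §2.1. [Neumann1998]
* J. Milnor, *Hyperbolic geometry: the first 150 years*, Bull. AMS 6 (1982), Appendix (the conjecture
  on the values `Л(πc/N)`). [Milnor1982]
-/

noncomputable section

open scoped BigOperators ComplexConjugate
open Literature.NumberTheory.Transcendental

namespace Summit.KontsevichZagierPeriods.HyperbolicBloch.ZagierDilogarithmCyclotomic

open CyclotomicPrimeSector
open Summit.KontsevichZagierPeriods.HyperbolicBloch.ZagierDilogarithm (lift_eq_zero_of_mem_closure
  lift_sum_zsmul_of)

/-- **Stub `stub_cyclotomicSectorTorsion_iff`: the full level-`N` cyclotomic sector of the crux, torsion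
form, is EQUIVALENT to Milnor's conjecture for `N` (every `N`, composite included).** Given folding to
the primitive upper half: Zagier's conjecture restricted to `N`-th roots of unity of `ℍ⁺` in torsion
form (every `ℤ`-relation among their `D`-values has a positive multiple of its formal combination in
`⟨dilogRelators⟩`) holds if and only if the Clausen values `D(ζ_N^c)`, `(c, N) = 1`, `0 < c < N/2`, are
`ℤ`-linearly independent. `⇒` by `stub_cyclotomicIndependence` (an explained primitive upper-half
combination is zero, applied to `M·m`); `⇐` by folding `M·x ≡ y` to the primitive upper half and the
soundness of the value map `[w] ↦ D(w)` on the relators: `D(y) = M·D(x) = 0`, so `y = 0` by Milnor.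
[cite: Milnor1982, Appendix] -/
theorem stub_cyclotomicSectorTorsion_iff :
    (∀ (N : ℕ) [NeZero N] (m : ZMod N → ℤ), ∃ M : ℕ, 0 < M ∧ ∃ b : ZMod N → ℤ,
      (∀ a, b a ≠ 0 → IsUnit a ∧ 0 < a.val ∧ 2 * a.val < N) ∧
      (M • ∑ c : ZMod N, m c • FreeAbelianGroup.of (Complex.exp (2 * Real.pi * Complex.I / N) ^ c.val) -
        ∑ a : ZMod N, b a • FreeAbelianGroup.of (Complex.exp (2 * Real.pi * Complex.I / N) ^ a.val)) ∈
        AddSubgroup.closure dilogRelators) →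
    ∀ (N : ℕ) [NeZero N],
      (∀ (k : ℕ) (u : Fin k → ℂ) (n : Fin k → ℤ), (∀ i, u i ^ N = 1) → (∀ i, 0 < (u i).im) →
          ∑ i, (n i : ℝ) * blochWignerDilog (u i) = 0 →
            ∃ M : ℕ, 0 < M ∧ M • (∑ i, n i • FreeAbelianGroup.of (u i)) ∈ AddSubgroup.closure dilogRelators) ↔
        (∀ m : ZMod N → ℤ, (∀ c, m c ≠ 0 → IsUnit c ∧ 0 < c.val ∧ 2 * c.val < N) →
          ∑ c : ZMod N, (m c : ℝ) *
              blochWignerDilog (Complex.exp (2 * Real.pi * Complex.I / N) ^ c.val) = 0 →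
            ∀ c, m c = 0) := by
  intro hfold N _
  classical
  -- the folding hypothesis at level `N`
  have hfoldN := fun m : ZMod N → ℤ => hfold N m
  clear hfold
  set ζ : ℂ := Complex.exp (2 * Real.pi * Complex.I / N) with hζ
  have hprim : IsPrimitiveRoot ζ N := Complex.isPrimitiveRoot_exp N (NeZero.ne N)
  constructor
  · -- `⇒`: restrict the sector statement to the support family, then cyclotomic independence
    intro hL m hsupp hsum
    set S := {c : ZMod N // m c ≠ 0} with hS
    set k := Fintype.card S
    set e : S ≃ Fin k := Fintype.equivFin S
    set z : Fin k → ℂ := fun i => ζ ^ ((e.symm i : ZMod N)).val with hz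
    set n : Fin k → ℤ := fun i => m (e.symm i) with hn
    have hpow : ∀ i, z i ^ N = 1 := fun i => by
      simp only [hz]
      rw [← pow_mul, mul_comm, pow_mul, hprim.pow_eq_one, one_pow]
    have him : ∀ i, 0 < (z i).im := fun i =>
      zeta_pow_im_pos N (hsupp _ (e.symm i).2).2.1 (hsupp _ (e.symm i).2).2.2
    -- sums over the support family are sums over `ℤ/N`
    have hreindex : ∀ (G : Type) [AddCommMonoid G] (F : ZMod N → ℤ → G), (∀ c, F c 0 = 0) →
        ∑ i, F (e.symm i) (n i) = ∑ c : ZMod N, F c (m c) := by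
      intro G _ F hF
      rw [Fintype.sum_equiv e.symm (fun i => F (e.symm i) (n i)) (fun s : S => F s (m s))
          (fun i => rfl),
        ← Finset.sum_subtype (Finset.univ.filter fun c => m c ≠ 0) (by simp)
          (fun c => F c (m c))]
      exact Finset.sum_filter_of_ne fun c _ hc h0 => hc (by rw [h0, hF])
    have hval : ∑ i, (n i : ℝ) * blochWignerDilog (z i) = 0 := by
      have := hreindex ℝ (fun c t => (t : ℝ) * blochWignerDilog (ζ ^ c.val)) (fun c => by simp)
      rw [this]
      exact hsum
    obtain ⟨M, hMpos, hmem⟩ := hL k z n hpow him hval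
    have hformal : (∑ i, n i • FreeAbelianGroup.of (z i)) =
        ∑ c : ZMod N, m c • FreeAbelianGroup.of (ζ ^ c.val) :=
      hreindex (FreeAbelianGroup ℂ) (fun c t => t • FreeAbelianGroup.of (ζ ^ c.val))
        (fun c => by simp)
    -- `M · Σ_c m_c [ζ^c] = Σ_c (M m_c) [ζ^c]` is explained
    have hmem' : ∑ c : ZMod N, ((M : ℤ) * m c) • FreeAbelianGroup.of (ζ ^ c.val) ∈
        AddSubgroup.closure dilogRelators := by
      rw [hformal, Finset.smul_sum] at hmem
      have h : ∑ c : ZMod N, ((M : ℤ) * m c) • FreeAbelianGroup.of (ζ ^ c.val) =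
          ∑ c : ZMod N, M • m c • FreeAbelianGroup.of (ζ ^ c.val) :=
        Finset.sum_congr rfl fun c _ => by rw [mul_zsmul, natCast_zsmul]
      rw [h]
      exact hmem
    have hM0 : ∀ c, (M : ℤ) * m c = 0 :=
      stub_cyclotomicIndependence N (fun c => (M : ℤ) * m c)
        (fun c hc => hsupp c (right_ne_zero_of_mul hc)) hmem'
    intro c
    exact (mul_eq_zero.1 (hM0 c)).resolve_left (by exact_mod_cast hMpos.ne')
  · -- `⇐`: group the family by the exponent, fold, apply the value map, then Milnor
    intro hMil k u n hpow him hsum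
    have hpt : ∀ i, ∃ c : ZMod N, 0 < c.val ∧ 2 * c.val < N ∧ u i = ζ ^ c.val := fun i =>
      exists_eq_zeta_pow N (hpow i) (him i)
    choose c hc using hpt
    have hu : ∀ i, ζ ^ (c i).val = u i := fun i => (hc i).2.2.symm
    -- the grouped coefficients
    obtain ⟨m, hmdef⟩ : ∃ m : ZMod N → ℤ,
        ∀ d, m d = ∑ i ∈ Finset.univ.filter (fun i => c i = d), n i := ⟨_, fun d => rfl⟩
    have hmsum : ∑ d : ZMod N, (m d : ℝ) * blochWignerDilog (ζ ^ d.val) = 0 := by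
      have h := sum_fiber_mul c n (fun d => blochWignerDilog (ζ ^ d.val))
      simp only [hu] at h
      simp only [hmdef]
      exact h.trans hsum
    have hformal : (∑ i, n i • FreeAbelianGroup.of (u i)) =
        ∑ d : ZMod N, m d • FreeAbelianGroup.of (ζ ^ d.val) := by
      have h := sum_fiber_zsmul c n (fun d => FreeAbelianGroup.of (ζ ^ d.val))
      simp only [hu] at h
      simp only [hmdef]
      exact h.symm
    -- fold `M · x ≡ y` to the primitive upper half
    obtain ⟨M, hMpos, b, hbsupp, hfoldmem⟩ := hfoldN m
    -- soundness of the value map: `Σ_a b_a D(ζ^a) = 0`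
    have hbval : ∑ a : ZMod N, (b a : ℝ) * blochWignerDilog (ζ ^ a.val) = 0 := by
      have h1 := lift_eq_zero_of_mem_closure hfoldmem
      rw [map_sub, map_nsmul, lift_sum_zsmul_of (fun d : ZMod N => ζ ^ d.val) m,
        lift_sum_zsmul_of (fun a : ZMod N => ζ ^ a.val) b, hmsum, smul_zero, zero_sub,
        neg_eq_zero] at h1
      exact h1
    -- Milnor: `b = 0`, so `y = 0` and `M · x` is explained
    have hb0 : ∀ a, b a = 0 := hMil b hbsupp hbval
    have hy : ∑ a : ZMod N, b a • FreeAbelianGroup.of (ζ ^ a.val) = 0 :=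
      Finset.sum_eq_zero fun a _ => by rw [hb0 a, zero_smul]
    rw [hy, sub_zero, ← hformal] at hfoldmem
    exact ⟨M, hMpos, hfoldmem⟩

end Summit.KontsevichZagierPeriods.HyperbolicBloch.ZagierDilogarithmCyclotomic

end
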